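import Summits.Schanuel.Schanuel.Theorems.RootDecomp1KIntegrality03

/-!
# RootDecomp1KIntegrality — lens 1, generation 55, NODE 15 «ODD-PLACE INTEGRALITY (Gauss on the level polynomial)» (RULE K-R45 payable clause; K-R46) — continuation (RootDecomp1KIntegrality04): §7 the family H17D, §8 position of the class, §9 bookkeeping

(lens-1 g55 NODE 15 HOME kernel K = HOME/decomp-schanuel-lens-1/g55/Integrality.lean 64be435d…, 1006 l, 116 thm + 1 lemma + 10 def, imports tree …RootDecomp1KLocalExponent06 ONLY (no Literature import); Probe / Ctrl0 / Ctrl + NODE-g55.md + SHA256SUMS; CLAIM L2635, crit EX-ANTE PRICE L2637 (ONE THEOREM ×1 under K-R45's payable clause «an infinite class of FRONTIER pairs made unconditional, any input» iff CHECKLIST K-g55; anti-salami: the one credit covers the integrality lever at BOTH ends of the level polynomial; RULE K-R46 pre-announced), census LIVENESS-v5 (GaussAt column) L2636 / crit L2639, NODE L2640 / REQUEST L2641, census STAGING NOTE 5 L2643, critic VERDICT L2642: CLEARED — THEOREM ×1 under K-R45 payable clause (EX-ANTE PRICE L2637), CHECKLIST K-g55 met; RULE K-R46 FIXED (toolkit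 of record ∪ Gauss divisibility on levelPoly; amended FRONTIER; tabled conditional-only members at 2 = M17P, L17P); PORT GO (verbatim; docstrings/provenance only; the dedup deletions announced L2643). Port by census-1 gen 22 as `RootDecomp1KIntegrality01–04` (`--supports stmt-Schanuel-33364`; no census credit): 01 = §1 the level polynomial `levelPoly` over ℤ and GAUSS AT THE ODD PLACES — `DomZero`, `leadingCoeff_levelPoly`, **`den_dvd_of_level`** (den r ∣ lc(c₀)·2^(v₂ den r)), `den_le_of_level` + §2 bounded height: `finite_rat_of_abs_le_den_le`, `levels_finite_of_bounded`; 02 = §3 ENGINE `thinFibreAt_of_dom_farClause` / `thinFibreAt_of_dom_slopeCond` (node 14's engine with the root condition DELETED) + §4 the class **`GaussAt m₀ P`** (intrinsic: P ≠ 0 ∧ deg_Y c₀ > deg_Y c_j (1 ≤ j ≤ xdeg P) ∧ SlopeCond) and THE THEOREM **`thinFibreAt_of_gaussAt : GaussAt m₀ P → ThinFibreAt m₀ P`** (every m₀), `gaussAt_xPolyP_iff`, `gaussAt_mono` + §5 the frontier-certified member **`thinFibreAt_H17P_all : 1 ≤ m₀ → ThinFibreAt m₀ H17P` HYPOTHESIS-FREE**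 (node 12's HeightComparison binder removed; `gaussAt_H17P`, `not_localAt_H17P`); 03 = §6 the members `RC2` = x²(Y−1)² + x(Y³−2) + Y⁵ (rational DOUBLE centre) and `GC2` = x²(Y²−17) + x(Y³+Y+1) + (Y⁴+Y³−2) (irrational simple ℚ₂-centres) at m₀ = 2 hyp-free, with their costume tests; 04 = §7 the infinite family `H17D D` + §8 position of the class (`not_gaussAt_L13`, `not_gaussAt_M17P`, …) + §9 bookkeeping ×0 (`GaussOffAt`). PORT EDITS: TWO dedup.landed twins DELETED for the tree decls (head dry-run): K's `finite_rat_of_abs_le_den_le` (≡ `RootDecomp1KLevelFinite.finite_rat_of_abs_le_den_le`, LevelFinite03 — same short name, resolved through K's own `open …LevelFinite`) and K's `partialSum_two_eq` (≡ `RootDecomp1KLevelFinite.lac_partialSum_two`, LevelFinite12 — the one use re-pointed by name); 36 one-line docstrings on undocumented computation lemmas of §6–§7 (statements quoted); otherwise none (K has no private / set_option / cite-token); provenance doc blocks + continuation headers = K's own open-lines; statements and proofs VERBATIM. Rung 0 — nothing here proves Schanuel, 33364, 33363, 31077 or ThinFibre 2; the class and members are HYPOTHESIS-FREE, §9 conditional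 on PadicSubspace / HeightComparison.)
-/

noncomputable section

namespace Summit.Schanuel.Schanuel.Theorems.RootDecomp1KIntegrality

open Polynomial LiouvilleNumber
open scoped Nat
open Summit.Schanuel.Schanuel.Theorems.RootDecomp1KTwoBaseCell (psNumer partialSum_eq_psNumer_div coprime_psNumer)
open Summit.Schanuel.Schanuel.Theorems.RootDecomp1KRelLiouvilleCell (partialSum_two_strictMono)
open Summit.Schanuel.Schanuel.Theorems.RootDecomp1KDegreeLadder
open Summit.Schanuel.Schanuel.Theorems.RootDecomp1KXLinear
open Summit.Schanuel.Schanuel.Theorems.RootDecomp1KXTop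
open Summit.Schanuel.Schanuel.Theorems.RootDecomp1KXAll
open Summit.Schanuel.Schanuel.Theorems.RootDecomp1KLevelFinite
open Summit.Schanuel.Schanuel.Theorems.RootDecomp1KSubspaceBranch
open Summit.Schanuel.Schanuel.Theorems.RootDecomp1KHeightGrading
open Summit.Schanuel.Schanuel.Theorems.RootDecomp1KHeightMachine
open Summit.Schanuel.Schanuel.Theorems.RootDecomp1KLocalExponent

/-! ## §7  AN INFINITE FAMILY OF MEMBERS at `m₀ = 2`: `H17D D = x³(Y² − 17)² + x²Y + x(Y + 1) + Y^D` -/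

/-- the `x`-coefficients of `H17D D := x³(Y² − 17)² + x²Y + x(Y + 1) + Y^D` (`H17D 5 = H17P`). -/
def h17D (D : ℕ) : ℕ → ℤ[X]
  | 0 => X ^ D
  | 1 => X + C 1
  | 2 => X
  | _ => (X ^ 2 - C 17) ^ 2

/-- **`H17D D = x³(Y² − 17)² + x²Y + x(Y + 1) + Y^D`**: top `(Y² − 17)²` (the irrational DOUBLE `ℚ₂`-centre `√17`,
threshold of record `2μ + 1 = 5`), `xdeg = 3`, `deg_Y = D`. -/
def H17D (D : ℕ) : ℤ[X][X] := xPolyP 3 (h17D D)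

/-- `(D : ℕ) : h17D D 0 = X ^ D`. -/
theorem h17D_zero (D : ℕ) : h17D D 0 = X ^ D := rfl
/-- `(D : ℕ) : h17D D 1 = X + C 1`. -/
theorem h17D_one (D : ℕ) : h17D D 1 = X + C 1 := rfl
/-- `(D : ℕ) : h17D D 2 = X`. -/
theorem h17D_two (D : ℕ) : h17D D 2 = X := rfl
/-- `(D : ℕ) : h17D D 3 = h17C 3`. -/
theorem h17D_three (D : ℕ) : h17D D 3 = h17C 3 := by rw [h17C_three]; rfl
/-- `(D : ℕ) : (h17D D 3).natDegree = 4`. -/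
theorem natDegree_h17D_three (D : ℕ) : (h17D D 3).natDegree = 4 := by rw [h17D_three, natDegree_h17C_three]
/-- `(D : ℕ) : h17D D 3 ≠ 0`. -/
theorem h17D_three_ne_zero (D : ℕ) : h17D D 3 ≠ 0 := by rw [h17D_three]; exact h17C_three_ne_zero

/-- `H17D 5 = H17P`. -/
theorem H17D_five : H17D 5 = H17P := by
  unfold H17D H17P xPolyP
  refine Finset.sum_congr rfl fun j hj => ?_
  have hj4 : j < 4 := Finset.mem_range.mp hj
  interval_cases j
  · rw [h17D_zero, h17C_zero]
  · rw [h17D_one, h17C_one]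
  · rw [h17D_two, h17C_two]
  · rw [h17D_three]

/-- dominance for `D ≥ 5`. -/
theorem domZero_h17D {D : ℕ} (hD : 5 ≤ D) : DomZero 3 (h17D D) := by
  intro j hj1 hj3
  rw [h17D_zero, natDegree_X_pow]
  interval_cases j
  · rw [h17D_one, natDegree_X_add_C]; omega
  · rw [h17D_two, natDegree_X]; omega
  · rw [natDegree_h17D_three]; omega

/-- subcritical slopes iff `D − 4 < 3·m₀`. -/
theorem slopeCond_h17D {D m₀ : ℕ} (hD : 5 ≤ D) (hDm : D < 3 * m₀ + 4) : SlopeCond m₀ 3 (h17D D) := by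
  intro j hj hdj
  rw [natDegree_h17D_three] at hdj ⊢
  interval_cases j
  · rw [h17D_zero, natDegree_X_pow] at hdj ⊢; omega
  · rw [h17D_one, natDegree_X_add_C] at hdj; omega
  · rw [h17D_two, natDegree_X] at hdj; omega

/-- **the family in the class**: `H17D D ∈ GaussAt m₀` for `5 ≤ D < 3·m₀ + 4`. -/
theorem gaussAt_H17D {D m₀ : ℕ} (hD : 5 ≤ D) (hDm : D < 3 * m₀ + 4) : GaussAt m₀ (H17D D) :=
  gaussAt_xPolyP 3 (h17D D) (h17D_three_ne_zero D) (domZero_h17D hD) (slopeCond_h17D hD hDm)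

/-- **`ThinFibreAt 2 (H17D D)` for `5 ≤ D ≤ 9`** — five members at the FRONTIER exponent of `H17P`, hypothesis-free. -/
theorem thinFibreAt_two_H17D {D : ℕ} (hD : 5 ≤ D) (hD9 : D ≤ 9) : ThinFibreAt 2 (H17D D) :=
  thinFibreAt_of_gaussAt (gaussAt_H17D hD (by omega))

/-- **`ThinFibreAt m₀ (H17D D)` for all `5 ≤ D < 3·m₀ + 4`** — an INFINITE class of members (every `D ≥ 5`, at every
`m₀ > (D − 4)/3`), hypothesis-free. -/
theorem thinFibreAt_H17D {D m₀ : ℕ} (hD : 5 ≤ D) (hDm : D < 3 * m₀ + 4) : ThinFibreAt m₀ (H17D D) :=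
  thinFibreAt_of_gaussAt (gaussAt_H17D hD hDm)

/-- the slope bound is where the class stops: `H17D 10 ∉ GaussAt 2` (`10 − 4 = 6 < 6` fails — a CRITICAL segment). -/
theorem not_gaussAt_two_H17D_ten : ¬ GaussAt 2 (H17D 10) := by
  intro h
  have := ((gaussAt_xPolyP_iff 3 (h17D 10) (h17D_three_ne_zero 10)).mp h).2 0 (by norm_num)
    (by rw [h17D_zero, natDegree_X_pow, natDegree_h17D_three]; norm_num)
  rw [h17D_zero, natDegree_X_pow, natDegree_h17D_three] at this
  omega

/-- `(D : ℕ) : xdeg (H17D D) = 3`. -/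
theorem xdeg_H17D (D : ℕ) : xdeg (H17D D) = 3 := xdeg_xPolyP 3 (h17D D) (h17D_three_ne_zero D)
/-- `(D : ℕ) : topX (H17D D) = h17C 3`. -/
theorem topX_H17D (D : ℕ) : topX (H17D D) = h17C 3 :=
  (topX_xPolyP 3 (h17D D) (h17D_three_ne_zero D)).trans (h17D_three D)
/-- `{D : ℕ} (hD : 5 ≤ D) : (H17D D).natDegree = D`. -/
theorem natDegree_H17D {D : ℕ} (hD : 5 ≤ D) : (H17D D).natDegree = D :=
  (natDegree_xPolyP_of_domZero 3 (h17D D) (domZero_h17D hD)).trans (by rw [h17D_zero, natDegree_X_pow])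

/-- for `D ≥ 6` the family is OUTSIDE node 12's height class at `2` (`deg_Y = D < 2·xdeg = 6` fails), whatever
`GeomIrreducible` says — these members were not even conditionally decided at `2` before node 15
(`D = 5` is `H17P`, decided by node 12 modulo `HeightComparison`). -/
theorem not_heightDecidedAt_two_H17D {D : ℕ} (hD : 6 ≤ D) : ¬ HeightDecidedAt 2 (H17D D) := fun h => by
  have := h.2; rw [natDegree_H17D (by omega), xdeg_H17D] at this; omega

/-- … nor in node 14's local class at `m₀ ≤ 4` (same top as `H17P`). -/
theorem not_localAt_H17D (D : ℕ) {m₀ : ℕ} (hm : m₀ ≤ 4) : ¬ LocalAt m₀ (H17D D) := fun h => by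
  have hR := rootCond_topX_of_localAt h
  rw [topX_H17D] at hR
  exact not_rootCond_h17C_three hm hR

/-- … nor in node 11's class at any `m₀` (top not separable). -/
theorem not_sepTopAt_H17D (D m₀ : ℕ) : ¬ SepTopAt m₀ (H17D D) := fun h => by
  have hsep := h.1
  rw [topX_H17D, ← topX_H17P] at hsep
  exact not_separable_topX_H17P hsep

/-! ## §8  POSITION OF THE CLASS (by name) and the members of record that are NOT in it -/

/-- dominance for `contactC` (`7 > 2, 5`). -/
theorem domZero_contact : DomZero 2 contactC := by
  intro j hj1 hj2
  rw [natDegree_contactC_zero]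
  interval_cases j
  · rw [natDegree_contactC_one]; norm_num
  · rw [natDegree_contactC_two]; norm_num

/-- dominance for `highContactC` (`9 > 1, 5`). -/
theorem domZero_highContact : DomZero 2 highContactC := by
  intro j hj1 hj2
  rw [natDegree_highContactC_zero]
  interval_cases j
  · rw [natDegree_highContactC_one]; norm_num
  · rw [natDegree_highContactC_two]; norm_num

/-- `contactC ∈ GaussAt 2` (it is ALSO in `LocalAt 2`: the two classes overlap; nothing new is claimed for it;
slopes by the tree's `slopeCond_contact`). -/
theorem gaussAt_two_contact : GaussAt 2 (xPolyP 2 contactC) :=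
  gaussAt_xPolyP 2 contactC pow_five_sub_one_ne_zero domZero_contact (slopeCond_contact le_rfl)

/-- `highContactC ∉ GaussAt 2` — dominance holds (`9 > 1, 5`) but the slope `9 − 5 = 4 < 2·2` is CRITICAL
(tree `not_slopeCond_two_highContact`); it IS decided at `2`, outside both classes, by emptiness (node 14). -/
theorem not_gaussAt_two_highContact : ¬ GaussAt 2 (xPolyP 2 highContactC) := fun h =>
  not_slopeCond_two_highContact ((gaussAt_xPolyP_iff 2 highContactC pow_five_sub_one_ne_zero).mp h).2

/-- `highContactC ∈ GaussAt 3` (slopes by the tree's `slopeCond_highContact`). -/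
theorem gaussAt_three_highContact : GaussAt 3 (xPolyP 2 highContactC) :=
  gaussAt_xPolyP 2 highContactC pow_five_sub_one_ne_zero domZero_highContact (slopeCond_highContact le_rfl)

/-- `m17C 2 ≠ 0`. -/
theorem m17C_two_ne_zero : m17C 2 ≠ 0 := fun h0 => by
  have := natDegree_m17C_two; rw [h0, natDegree_zero] at this; omega

/-- the SLOPES of `M17P` are subcritical at `m₀ ≥ 2` (`3 − 2 = 1 < 2·m₀`, `3 − 2 = 1 < m₀`): dominance is its ONLY failing datum. -/
theorem slopeCond_m17C {m₀ : ℕ} (hm : 2 ≤ m₀) : SlopeCond m₀ 2 m17C := by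
  intro j hj hdj
  rw [natDegree_m17C_two] at hdj ⊢
  interval_cases j
  · rw [natDegree_m17C_zero]; omega
  · rw [natDegree_m17C_one]; omega

/-- the SLOPES of `L13` are subcritical at `m₀ ≥ 2` (`j = 1`: `3 − 2 = 1 < m₀`; `j = 0` carries no far point). -/
theorem slopeCond_l13C {m₀ : ℕ} (hm : 2 ≤ m₀) : SlopeCond m₀ 2 l13C := by
  intro j hj hdj
  rw [natDegree_l13C_two] at hdj ⊢
  interval_cases j
  · rw [natDegree_l13C_zero] at hdj; omega
  · rw [natDegree_l13C_one]; omega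

/-- `mixedC 2 ≠ 0`. -/
theorem mixedC_two_ne_zero : mixedC 2 ≠ 0 := by
  show (X ^ 5 - 1 : ℤ[X]) ≠ 0; exact pow_five_sub_one_ne_zero

/-- the SLOPES of `mixedC` are vacuously subcritical at every `m₀` (no `c_j` exceeds the top in degree). -/
theorem slopeCond_mixed (m₀ : ℕ) : SlopeCond m₀ 2 mixedC := by
  intro j hj hdj
  exfalso
  have e2 : (mixedC 2).natDegree = 5 := by show (X ^ 5 - 1 : ℤ[X]).natDegree = 5; exact natDegree_pow_five_sub_one
  rw [e2] at hdj
  interval_cases j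
  · have e0 : (mixedC 0).natDegree = 5 := by
      show (X ^ 5 - 1 : ℤ[X]).natDegree = 5; exact natDegree_pow_five_sub_one
    rw [e0] at hdj; omega
  · have e1 : (mixedC 1).natDegree = 1 := by
      show (X + 1 : ℤ[X]).natDegree = 1; rw [← C_1, natDegree_X_add_C]
    rw [e1] at hdj; omega

/-- **`M17P ∉ GaussAt m₀` at ANY `m₀`** (node 11's FRONTIER member, `⟸ PadicSubspace`): `deg c₁ = 3 = deg c₀` —
the `Y`-leading coefficient of `M17P` is `x + 1`, NOT a constant (`J_D = {0, 1}`); node 15 says nothing about it. -/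
theorem not_gaussAt_M17P (m₀ : ℕ) : ¬ GaussAt m₀ M17P := by
  intro h
  have := ((gaussAt_xPolyP_iff 2 m17C m17C_two_ne_zero).mp h).1 1 le_rfl (by norm_num)
  rw [natDegree_m17C_one, natDegree_m17C_zero] at this
  exact lt_irrefl _ this

/-- **`L13 ∉ GaussAt m₀` at ANY `m₀`** (node 13's machine member): `deg c₁ = 3 > deg c₀ = 2` (`J_D = {1}`). -/
theorem not_gaussAt_L13 (m₀ : ℕ) : ¬ GaussAt m₀ L13 := by
  intro h
  have := ((gaussAt_xPolyP_iff 2 l13C l13C_two_ne_zero).mp h).1 1 le_rfl (by norm_num)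
  rw [natDegree_l13C_one, natDegree_l13C_zero] at this
  omega

/-- a TIE `J_D = {0, k}` is REFUSED: `mixedC` (`x²(Y⁵ − 1) + x(Y + 1) + (Y⁵ − 1)`, `deg c₂ = 5 = deg c₀`) is in NO
`GaussAt m₀` (its `Y`-leading coefficient `x² + 1` is not constant). -/
theorem not_gaussAt_mixed (m₀ : ℕ) : ¬ GaussAt m₀ (xPolyP 2 mixedC) := by
  intro h
  have := ((gaussAt_xPolyP_iff 2 mixedC mixedC_two_ne_zero).mp h).1 2 (by norm_num) le_rfl
  have e2 : (mixedC 2).natDegree = 5 := by show (X ^ 5 - 1 : ℤ[X]).natDegree = 5; exact natDegree_pow_five_sub_one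
  have e0 : (mixedC 0).natDegree = 5 := by show (X ^ 5 - 1 : ℤ[X]).natDegree = 5; exact natDegree_pow_five_sub_one
  rw [e2, e0] at this
  exact lt_irrefl _ this

/-! ## §9  BOOKKEEPING (×0): the residual of record re-graded by the integrality class -/

/-- [residual statement def — NOT proved; census convention] Siegel's clause OFF everything decided at `m₀`, OFF the
height-machine class, OFF the local class AND OFF the integrality class `GaussAt m₀`. -/
def GaussOffAt (m₀ : ℕ) : Prop :=
  ∀ P : ℤ[X][X], Prime P → 2 ≤ P.natDegree → ¬ DecidedAt m₀ P → ¬ MachineDecidedAt m₀ P → ¬ LocalAt m₀ P →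
    ¬ GaussAt m₀ P → SiegelClause P

/-- the weakening, PROVED: `LocalOffAt m₀ → GaussOffAt m₀`. -/
theorem gaussOffAt_of_localOffAt {m₀ : ℕ} (h : LocalOffAt m₀) : GaussOffAt m₀ :=
  fun P hP hd hnd hnm hnl _ => h P hP hd hnd hnm hnl

/-- **the residual re-graded, NO binder**: `ThinFibre m₀ ⟸ GaussOffAt m₀` (`m₀ ≥ 2`) — after node 15 the
UNCONDITIONAL part at `m₀` is `DecidedAt ∨ MachineDecidedAt ∨ LocalAt ∨ GaussAt`. -/
theorem thinFibre_of_gaussOffAt {m₀ : ℕ} (hm : 2 ≤ m₀) (hR : GaussOffAt m₀) : ThinFibre m₀ := by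
  refine thinFibre_of_prime hm fun P hP hd => ?_
  by_cases h : DecidedAt m₀ P
  · exact thinFibreAt_of_decidedAt hm hP.ne_zero h
  by_cases h' : MachineDecidedAt m₀ P
  · exact thinFibreAt_of_machineDecidedAt h'
  by_cases h'' : LocalAt m₀ P
  · exact thinFibreAt_of_localAt h''
  by_cases hg : GaussAt m₀ P
  · exact thinFibreAt_of_gaussAt hg
  exact thinFibreAt_of_levelFinite (levelFinite_of_siegelClause (hR P hP hd h h' h'' hg)) m₀

end Summit.Schanuel.Schanuel.Theorems.RootDecomp1KIntegrality

end
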